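import Mathlib
import HarnessLib
import HarnessLib.Audit
import Summits.CriticalPhenomena.Statement
import Literature.Computability.QuantumComplexity.PermanentHardness

/-!
Route: HalfHolomorphic

CLOSED (retired) 2026-08-15T13:47:56Z by operator:999:1257524 — reason: not-a-thesis: assembly does not conclude the sub-problem Statement — note: D-0027 §2.1 audit (human 2026-08-15: routes that do not decide the summit are removed): the assembly concludes `Barrier`, not the sub-problem statement; a NEW conforming route may be opened from the same idea (generated `closes : … → _root_.Ising3DConformalLimit`).. The file is kept as the record of this route; refuted decls are indexed as negative knowledge (`ledger negatives`).

# Route HalfHolomorphic — At most half-holomorphic — exact free-b.c. Ising Z on finite site sets of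
Z^3 is #P-hard from Valiant's permanent (proved in tree), so no complete domain-uniform 3D Kac-Ward
calculus unless #P ⊆ FP

BARRIER ROUTE (negative knowledge, D-0021), realising card at-most-half-holomorphic. Declared up
front: X does NOT imply Summit.CriticalPhenomena.Ising3DConformalLimit nor its negation — X is a
no-go theorem for a technique class and the Assembly item concludes in X (precedent: route
TaylorResolutionBarrier of AnomalousDissipation).
Dictionary (all theorems): the engine of the planar proofs (Smirnov2010, ChelkakSmirnov2012,
ChelkakHonglerIzyurov2015) is an observable solving a CLOSED, WELL-POSED discrete boundary value
problem on EVERY finite planar domain, and the critical fermionic observable IS the inverse Kac–Ward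
operator (Lis2013), det(Kac–Ward) computing Z on every finite planar graph at every coupling
(KacWard1952, Cimasoni2012): exact planar discrete analyticity and the FKT/Kac–Ward polynomial-time
ALGORITHM for Z are one object.
It suffices to show X = Barrier: for the free-boundary nearest-neighbour Ising model on an ARBITRARY
finite site set Λ ⊂ ℤ³ (all lattice bonds inside Λ; coupling tanh β = p/q), (i) computing the
even-subgraph (high-temperature) polynomial E_Λ(x) = Σ_{S ⊆ bonds(Λ), S even} x^|S| in polynomial
time puts #P inside FP, and (ii) for EVERY rational coupling 0 < p/q < 1, computing the single
natural number q^|bonds| E_Λ(p/q) = 2^(−|Λ|) cosh(β)^(−|bonds|) q^|bonds| Z_Λ^free(β) in polynomial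
time (as a binary-answer oracle) puts #P inside FP.
Reading (the technique class CLOC of the card): a COMPLETE linear observable calculus on ℤ³ —
poly(|Λ|) unknowns, translation-invariant finite-range linear relations with locally computable
coefficients INCLUDING the boundary relations, unique solvability on every finite Λ, and Z_Λ (or the
ratios Z_Λ/Z_(Λ−x) that telescope to it) read off in polynomial time — is such an algorithm
(Gaussian elimination); coupling-uniform calculi (like Kac–Ward) give (i), fixed-coupling ones give
(ii). Hence 3D ISING OBSERVABLES ARE AT MOST HALF-HOLOMORPHIC: any exact local linear structure a
domain-uniform ℤ³ observable satisfies is underdetermined (like the planar q ≠ 2 FK / O(n) / SAW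
half-Cauchy–Riemann relations), exponential-size (Regge–Zecchina's 4^g Pfaffians, loop-space
equations, transfer matrices), asymptotic, or special-domain-only — unless #P ⊆ FP. PFUN below is
the explicit string function code(Λ) ↦ code([e_0(Λ), …, e_B(Λ)]) (B = |bonds(Λ)|, e_j = number of
even j-bond subgraphs; non-codes ↦ []), ZFUN p q is code(Λ) ↦ Σ_(S even) p^|S| q^(B−|S|) (non-codes
↦ 0), both over the tree's encodings (encodingIntBool³.listBool, encodingListNatBool); the target
block carries the identical term.
Lean: `((fun w : List Bool => (((Literature.Computability.Complexity.encodingIntBool.pairBool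
(Literature.Computability.Complexity.encodingIntBool.pairBool
Literature.Computability.Complexity.encodingIntBool)).listBool).decode w).elim ([] : List Bool) (fun
Λ : List (ℤ × ℤ × ℤ) => (Literature.Computability.Complexity.encodingListNatBool).encode
((List.range (((((Λ).toFinset ×ˢ (Λ).toFinset).filter (fun xy : (ℤ × ℤ × ℤ) × (ℤ × ℤ × ℤ) =>
((xy.1).1 - (xy.2).1).natAbs + ((xy.1).2.1 - (xy.2).2.1).natAbs + ((xy.1).2.2 - (xy.2).2.2).natAbs =
1)).image (fun xy => s(xy.1, xy.2))).card + 1)).map (fun j : ℕ => ((((((Λ).toFinset ×ˢ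
(Λ).toFinset).filter (fun xy : (ℤ × ℤ × ℤ) × (ℤ × ℤ × ℤ) => ((xy.1).1 - (xy.2).1).natAbs +
((xy.1).2.1 - (xy.2).2.1).natAbs + ((xy.1).2.2 - (xy.2).2.2).natAbs = 1)).image (fun xy => s(xy.1,
xy.2))).powerset.filter (fun S => S.card = j ∧ (∀ v ∈ (Λ).toFinset, Even ((S.filter (fun e : Sym2 (ℤ
× ℤ × ℤ) => v ∈ e)).card)))).card))))) ∈ Literature.Computability.Complexity.FP → ∀ f ∈
Literature.Computability.Complexity.SharpP, (Computability.encodeNat ∘ f) ∈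
Literature.Computability.Complexity.FP) ∧ (∀ p q : ℕ, 0 < p → p < q →
Literature.Computability.Complexity.Oracle.ofFun (fun w : List Bool =>
((((Literature.Computability.Complexity.encodingIntBool.pairBool
(Literature.Computability.Complexity.encodingIntBool.pairBool
Literature.Computability.Complexity.encodingIntBool)).listBool).decode w).elim 0 (fun Λ : List (ℤ ×
ℤ × ℤ) => ∑ S ∈ ((((Λ).toFinset ×ˢ (Λ).toFinset).filter (fun xy : (ℤ × ℤ × ℤ) × (ℤ × ℤ × ℤ) =>
((xy.1).1 - (xy.2).1).natAbs + ((xy.1).2.1 - (xy.2).2.1).natAbs + ((xy.1).2.2 - (xy.2).2.2).natAbs =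
1)).image (fun xy => s(xy.1, xy.2))).powerset with (∀ v ∈ (Λ).toFinset, Even ((S.filter (fun e :
Sym2 (ℤ × ℤ × ℤ) => v ∈ e)).card)), p ^ S.card * q ^ (((((Λ).toFinset ×ˢ (Λ).toFinset).filter (fun
xy : (ℤ × ℤ × ℤ) × (ℤ × ℤ × ℤ) => ((xy.1).1 - (xy.2).1).natAbs + ((xy.1).2.1 - (xy.2).2.1).natAbs +
((xy.1).2.2 - (xy.2).2.2).natAbs = 1)).image (fun xy => s(xy.1, xy.2))).card - S.card)) : ℕ)) ∈
Literature.Computability.Complexity.FP → ∀ f ∈ Literature.Computability.Complexity.SharpP,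
(Computability.encodeNat ∘ f) ∈ Literature.Computability.Complexity.FP)`

## Assembly
Glue in the tree's FP calculus, provable once the two supports are in (they are: ProofTest.lean):
compose the one-query reductions of SymbolicHardness (per01Fn → PFUN) and
ValuesDetermineCoefficients (PFUN → ZFUN p q) into per01Fn → ZFUN p q (PRE = pre₂ ∘ pre₁; POST ⟨w,
a⟩ = post₁ ⟨w, post₂ ⟨pre₁ w, a⟩⟩ via fanoutFn/fstF/sndF and comp_mem_FP), then HardnessOfReduction
and CollapseOfPolyTime give conjunct (ii); for conjunct (i), PFUN ∈ FP makes Oracle.ofFun per01Fn =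
(fun w ↦ post₁ (boolPair w (PFUN (pre₁ w)))) ∈ FP, and CollapseOfPolyTime applies to per01Fn itself
with Valiant's theorem. NOT an implication to the summit (barrier route).

Rationale: WHY THIS LINE. The complexity face of "no discrete holomorphicity in 3D": the catalogue entry
LiouvilleRigidityNarrow records that Liouville rigidity does NOT block a ℤ³ observable solving a
closed discrete Dirac-type boundary value problem, and that the one recorded obstruction,
Loebl–Masbaum's optimality of the 4^g-Pfaffian Arf-invariant formula (LoeblMasbaum2011 Thm 4;
ReggeZecchina2000), constrains only Pfaffian representations, "so 'no discrete holomorphicity on ℤ³'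
stays a heuristic" (DuminilCopinICM2022 §8.4). This route makes it a theorem for every COMPLETE
domain-uniform calculus, whatever its decoration alphabet or stencil, by counting unknowns only:
Kac–Ward = FKT is an algorithm (KacWard1952, Lis2013, Cimasoni2012; matchgates capture exactly the
planar-only tractable counting problems, CaiLuXia2017), while off the plane exact Ising/Tutte
evaluation is #P-hard (JaegerVertiganWelsh1990; on 3-regular hosts doi:10.1007/978-3-642-13562-0_30;
lattice framing Istrail2000, Barahona1982). Imported area: counting complexity, resting on a PROVED
cone fact — Valiant's theorem is a theorem of the tree
(Literature.Computability.QuantumComplexity.permanent01_isSharpPHardFun_holds, Valiant1979 Thm 1) —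
with the tree's FP-closure and one-query oracle machinery (postPre_mem_FPRel,
OracleAlg.FPRel_subset_FPRel_of_mem_FPRel, FPRel_subset_FP_of_mem_FP) and the GridSAW barrier files
(LiskiewiczOgiharaToda2003 formalisation) as the template for lattice embeddings. The new
mathematics is an elementary, interpolation-free Valiant-stretch chain: permanent = #PM of a
bipartite graph → parsimonious path-gadget degree reduction to maximum degree 3 → N long pendant
paths turn #PM into ONE coefficient of the even-subgraph polynomial → 2k-subdivisions embed as
INDUCED subgraphs of ℤ³ with E_Λ(x) = E_G(x^(2k)) → one oracle value at p/q on an m-dilated copy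
returns all coefficients by mixed-radix peeling (gcd(p,q) = 1). What prior routes and the negatives
index do not do: the five open routes of the sub (HyperoctahedralRP, PerfectScreening, IsingCFTData,
IsingEuclidUpgrade, AnomalousForcesInteraction) are positive lines; the negatives index has no
Ising3D entry; this is the sub's first negative-knowledge route and converts every future "3D
s-holomorphicity" claim into a falsifiable algorithmic one (does it compute Z_Λ on all finite Λ in
polynomial time? then #P ⊆ FP).

RANKED CRUXES. #0 Barrier (target) — X as in § Thesis: (i) PFUN ∈ FP ⇒ every #P function (as
encodeNat ∘ f) is in FP; (ii) for all naturals 0 < p < q, Oracle.ofFun (ZFUN p q) ∈ FP ⇒ the same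
collapse. PFUN = coefficient list [e_0, …, e_B] of the even-subgraph polynomial of the
nearest-neighbour graph on the decoded site list Λ ⊂ ℤ × ℤ × ℤ (duplicates removed; non-codes ↦ []);
ZFUN p q = Σ_(S ⊆ bonds(Λ), all Λ-degrees even) p^|S| q^(B−|S|) = q^B E_Λ(p/q) (non-codes ↦ 0).
Sanity (planner's Test.lean, native_decide): unit square ↦ q⁴ + p⁴ = 97 at (p,q) = (2,3),
coefficient list [1,0,0,0,1]; three collinear sites ↦ q². (why it might fail: Only if #P ⊆ FP-type
collapses are provable or via a modelling slip (encodings, Oracle.ofFun = binary answers, non-codes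
↦ 0/[]); calculi defined only on thick domains or only at β_c are NOT covered — a relevance risk
recorded under Kill criteria, not a truth risk.) [JaegerVertiganWelsh1990, Valiant1979, Istrail2000,
LiskiewiczOgiharaToda2003, doi:10.1007/978-3-642-13562-0_30, LoeblMasbaum2011]
#2 SymbolicHardness (crux) — ONE-QUERY REDUCTION FROM VALIANT'S PERMANENT TO THE LATTICE POLYNOMIAL:
there are pre, post ∈ FP with encodeNat (per01Fn w) = post (boolPair w (PFUN (pre w))) for every
string w. Intended proof (elementary, sizes polynomial): decode w as a 0/1 matrix A (else the answer
is 0 and post says so after re-checking w); G(A) = bipartite graph of A, #PM(G(A)) = per A; replace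
each vertex of degree d ≥ 2 by a path v¹u¹v²u²…u^(d−1)v^d with the i-th original edge moved to vⁱ
(parsimonious for perfect matchings; maximum degree 3) giving H with 2N vertices; pair the vertices
of H arbitrarily and join each pair by a NEW path of M = |E(H)| + 1 bonds (maximum degree 4): then
e_(NM+N)(H⁺) = #PM(H) exactly (an even subgraph contains each pendant path entirely or not at all;
with all N present, parity forces odd H-degrees and NM + N bonds force degree exactly 1; with fewer
paths the size stays below NM) — checked by brute force in the planner's check.py on C₆ (2 = 2),
K₃,₃ (6 = 6) and random maximum-degree-3 graphs; embed the 2k-subdivision of H⁺ as an INDUCED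
subgraph Λ of ℤ³ (SubdivisionEmbedding made explicit and FP) so that e_(2kj)(Λ) = e_j(H⁺); post
reads entry 2k(NM+N) of the decoded list and re-encodes it with encodeNat. FP bookkeeping with the
tree's combinators (comp_mem_FP, fanoutFn, divFn/remFn, boolPair decoders) as in
PermanentHardnessProofs.lean and the GridSAW* files. [deps: SubdivisionEmbedding] [difficulty: XL]
(why it might fail: Not the combinatorics but its Lean size: a five-stage explicit string map with
FP certificates (GridSAW's analogous Theorem 7 took ~30 files); a slip in conventions (per01Fn's
matrix code, non-canonical input codes, exact list format of PFUN) breaks the identity as an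
equation on ALL strings.) [Valiant1979, JaegerVertiganWelsh1990, DagumLuby1992,
LiskiewiczOgiharaToda2003]
#3 ValuesDetermineCoefficients (crux) — ONE VALUE AT ONE RATIONAL COUPLING RETURNS THE WHOLE
POLYNOMIAL, IN FP: for all naturals 0 < p < q there are pre, post ∈ FP with PFUN w = post (boolPair
w (encodeNat (ZFUN p q (pre w)))) for every string w. Intended proof: pre decodes w to Λ (if w is a
non-code, post sees it on its first component and answers []), computes B = |bonds(Λ)| and the
m-DILATION Λ_m := mΛ ∪ {m x + j e_i : {x, x+e_i} a bond of Λ, 0 ≤ j ≤ m} with m = B + 1, whose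
nearest-neighbour graph is exactly the m-subdivision of that of Λ (for m ≥ 2 filled segments of
distinct bonds stay at lattice distance ≥ 2 except at shared ends; sites of Λ at distance ≥ 2 stay
non-adjacent) — so ZFUN p q (code Λ_m) = Σ_j e_j(Λ) P^j Q^(B−j) with P = p^m, Q = q^m coprime
(identity E_(Λ_m)(x) = E_Λ(x^m) checked by brute force in check.py on random site sets, m = 2, 3);
since e_j ≤ 2^B < P when p ≥ 2, peel: e_0 ≡ W·Q^(−B) (mod P), subtract e_0 Q^B, divide by P, repeat
B times; when p = 1 read the base-Q digits instead (Q = q^m > 2^B); post re-encodes [e_0, …, e_B]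
with encodingListNatBool. Big-integer arithmetic in FP with the tree's divFn/remFn/addFn and a
polynomially bounded loop. [difficulty: L] (why it might fail: True by peeling (gcd(p^m, q^m) = 1,
coefficients ≤ 2^B < modulus); the risk is Lean-size only — an FP certificate for a (B+1)-round
big-integer loop and the exact canonical output format PFUN prescribes (length B+1, encodeNat
entries).) [JaegerVertiganWelsh1990, Valiant1979, LiskiewiczOgiharaToda2003]
#4 SubdivisionEmbedding (crux) — EVERY FINITE SIMPLE GRAPH OF MAXIMUM DEGREE ≤ 6 EMBEDS IN ℤ³ AS AN
INDUCED, EQUAL-LENGTH, EVEN SUBDIVISION: for a loopless edge list E on Fin n without repeated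
unordered edges and all degrees ≤ 6 there is k₀ such that for every k ≥ k₀ there are an injective
placement φ : Fin n → ℤ³ and lattice paths π e (self-avoiding site lists, consecutive sites at
ℓ¹-distance 1) of exactly 2k bonds from φ e.1 to φ e.2 (e ∈ E), meeting vertex images only at their
own two ends, pairwise disjoint away from vertex images, and INDUCED: any two sites of Λ = φ(Fin n)
∪ ⋃ π e at ℓ¹-distance 1 are consecutive on some π e (hence the nearest-neighbour graph on Λ is the
2k-subdivision of (Fin n, E), e_(2kj)(Λ) = e_j and all other coefficients vanish). Construction
sketch: φ i = (8i, 0, 0) (even sublattice ⇒ all path lengths even), the six lattice directions as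
ports, edge number m routed up to a private slab z ∈ [4m+6, 4m+9] and back (no crossings in 3D),
lengths equalised to any 2k ≥ 2k₀ ≍ n + |E| by U-detours of width 2 inside the slab (adds any even
amount and keeps inducedness: parallel runs at distance 2). [difficulty: M] (why it might fail: As
typed: inducedness near a degree-6 image (all six ports busy) together with 'exactly 2k for ALL k ≥
k₀' needs detours that stay ≥ 2 away from every other path and port; a mis-set clause (not the
folklore fact) is the risk — a refutation means RESTATE.) [LiskiewiczOgiharaToda2003, Istrail2000,
Barahona1982]
#9 HardnessOfReduction (support) — HARDNESS TRANSFER (provable now; 8-line script rc 0 in the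
planner's ProofTest.lean): if pre, post ∈ FP and encodeNat (per01Fn w) = post (boolPair w (encodeNat
(Z (pre w)))) for all w, then IsSharpPHardFun Z — Valiant (permanent01_isSharpPHardFun_holds) puts
encodeNat ∘ g in FPRel (Oracle.ofFun per01Fn) for every g ∈ #P, the identity puts Oracle.ofFun
per01Fn in FPRel (Oracle.ofFun Z) (postPre_mem_FPRel (self_mem_FPRel _) hpre hpost, funext +
Oracle.ofFun_apply), and OracleAlg.FPRel_subset_FPRel_of_mem_FPRel composes. Imports:
QuantumComplexity.PermanentHardnessProofs, Complexity.OracleClosure, Complexity.CountingProofs.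
[difficulty: provable-now] [Valiant1979, AroraBarak2009]
#9 CollapseOfPolyTime (support) — COLLAPSE (provable now; 2-line script rc 0 in ProofTest.lean): a
#P-hard Z whose binary-answer oracle Oracle.ofFun Z lies in FP puts every #P function (as encodeNat
∘ f) in FP — `FPRel_subset_FP_of_mem_FP hFP (hZ f hf)` (OracleEmptyFP.lean). [difficulty:
provable-now] [AroraBarak2009, Valiant1979]

TWO-LAYER PLAN. Foreseen glued splits (k ≤ 3, depth 1), filed only after SubdivisionEmbedding
closes: SymbolicHardness ⇐ GadgetIdentity (for the explicit graph H⁺(A): e_(NM+N)(H⁺(A)) = per A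
with |V|, |E| ≤ poly(n)) → ExplicitEmbeddingFP (the SubdivisionEmbedding construction as an FP
string map (A, k) ↦ code Λ with e_(2kj)(Λ) = e_j(H⁺)) → SymbolicHardness (glue: read one list entry
in FP). ValuesDetermineCoefficients ⇐ DilationIdentity (ZFUN p q on the code of Λ_m equals Σ_j e_j
p^(mj) q^(m(B−j))) → PeelingFP → ValuesDetermineCoefficients.

KILL CRITERIA. Truth: SubdivisionEmbedding refuted as typed ⇒ RESTATE (clause repair), never a
close; SymbolicHardness or ValuesDetermineCoefficients can only die by a modelling error (repair:
restate the PFUN/ZFUN conventions) — their arithmetic cores are checked on small cases (check.py)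
and a genuine counterexample to either identity would show there. Relevance (what retires the LINE;
close superseded or with a census): (a) a convergence-to-conformal-invariance proof anywhere driven
by an UNDERDETERMINED (half-Cauchy–Riemann) linear observable relation (planar FK q = 3, O(n), SAW)
— then "at most half-holomorphic" stops biting on 3D; (b) a polynomial-time exact Z on all thick or
solid Λ (no width-1 tubes) would show the barrier's instance class is the whole story and shrink it
to a statement about thin domains — pivot: file hardness for discretised smooth domains with
boundary data as a new crux; (c) #P ⊆ FP moots everything. A `known` novelty verdict on the hardness
statement (a printed #P-hardness of ferromagnetic Ising on ℤ³-subgraphs) cheapens rank 2 to a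
citation but does not kill the barrier deliverable.

NOT DECOMPOSED YET. The gadget identity and the explicit FP embedding (children of SymbolicHardness)
and the dilation identity / peeling loop (children of ValuesDetermineCoefficients), see Two-layer
plan; a formal CLOC structure with `cloc_implies_polytime` (Gaussian elimination in FP) —
deliberately NOT an item: the barrier is stated GridSAW-style directly on the technique class
"polynomial-time exact evaluation on every finite Λ", with the observable-calculus reading in the
docstring; hardness for THICK induced domains with prescribed boundary data (open, different
embedding); the antiferromagnet needs nothing (Λ ⊂ ℤ³ is bipartite, E_Λ is even) and couplings with
p/q ≥ 1 (complex β) are not wanted.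

CHEAPEST FALSIFIER. Run first (minutes): (1) the pendant-path identity e_(NM+N)(H⁺) = #PM(H) on C₆,
K₃,₃ and random maximum-degree-3 graphs — DONE by the planner (check.py: 2 = 2, 6 = 6, five random
cases equal); (2) the dilation identity E_(Λ_m)(x) = E_Λ(x^m) on random ℤ³ site sets, m = 2, 3 —
DONE (all equal); (3) the inline Lean definitions on the unit square — DONE (Test.lean,
native_decide: 97, [1,0,0,0,1]); (4) the one lookup that would downgrade rank 2 to `known`: a
printed #P-hardness of the uniform ferromagnetic Ising partition function on finite subgraphs / site
subsets of ℤ³ at fixed rational temperature (Istrail2000 uses signs {−J,0,+J}; Cai–Kowalczyk 2010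
uses 3-regular hosts; JaegerVertiganWelsh1990 general graphs; none found for lattice site sets with
crossref — searchd/galaxy were down, so a refuter should re-run `lit galaxy search "Ising partition
function cubic lattice subgraphs #P-hard" --star all`).

NUMBERS. Planar side: Z of any finite planar graph with arbitrary couplings = one 2|E| × 2|E|
Kac–Ward determinant (KacWard1952; Cimasoni2012 Thm 1.1; Lis2013 Thm 1.1: critical fermionic
observable = inverse Kac–Ward entries); genus g costs 4^g Pfaffians and no fewer in the Arf-formula
class (ReggeZecchina2000; LoeblMasbaum2011 Thm 4). Off-plane: Tutte plane #P-hard off 9 special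
points, including the Ising hyperbola (JaegerVertiganWelsh1990), bipartite planar case
doi:10.1017/s0963548300000195, planar bounded degree doi:10.1137/s0097539704446797, 3-regular Ising
[a,1,a] #P-hard for real a ∉ {0, ±1} (doi:10.1007/978-3-642-13562-0_30); 0/1 permanent #P-hard
(Valiant1979 Thm 1 — PROVED in tree); #PM of 3-regular bipartite graphs #P-complete (DagumLuby1992).
Sizes in the intended reduction for an n × n matrix: |V(H)| ≤ 2n², M ≤ 3n² + 1, k = O(|V(H⁺)| +
|E(H⁺)|) = O(n⁴), |Λ| = O(n⁸) sites; dilation factor m = B + 1. Items at open: 7 (target, assembly,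
3 cruxes, 2 supports).

DEFINITION REQUESTS. Filed after open (`ledger workitem add --kind definition`): notion
`IsingEvenSubgraphCountZ3`, topic Literature/Barriers/CriticalPhenomena — the string functions PFUN
/ ZFUN p q of this route as named Literature definitions (`isingCoeffsZ3`, `isingCountZ3 p q` over
`(encodingIntBool.pairBool (encodingIntBool.pairBool encodingIntBool)).listBool` and
`encodingListNatBool`), the technique-class predicates `HasPolyTimeIsingZ3Coeffs`,
`HasPolyTimeIsingZ3 p q`, and the catalogue entry `IsingCompleteObservableCalculus3D` (BARRIER block
— technique_class: complete-linear-observable-calculus, 3D-Kac–Ward, s-holomorphic-transplant;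
evasions_known: underdetermined relations, exponential-size structures, asymptotic identities,
uniform-model-on-boxes identities, approximation (JerrumSinclair1993 FPRAS); scope_caveats: thin
instances (width-1 tubes), rational couplings, conditional on #P ⊄ FP), to be vendored from this
route's Theorems once SymbolicHardness lands. No cite-fact is needed: the base fact (Valiant1979) is
a theorem of the tree.

Novelty: Searches (2026-08-15, this planner; searchd and galaxyd saturated this session — connection reset /
"queued too long > 90 s", OpenAlex/arXiv/S2 HTTP 429 — so crossref and the in-tree catalogue
answered): `lean search` over Literature for
Vertigan|Jaeger|Tutte|Kac-Ward|Kasteleyn|permanent|PerfectMatching (found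
GridSAWCountingSharpPComplete* for the SAW conjunct, HubbardSuperconductivity/SignProblemNPHard* =
Barahona's ISINGGROUND NP-complete DISCHARGED, QuantumComplexity/PermanentHardness(Proofs) = Valiant
DISCHARGED, LiouvilleRigidityNarrow naming LoeblMasbaum2011 Thm 4 as the only recorded complexity
shadow); `lit search --source crossref` ×7: "Ising partition function complexity #P-hard bounded
degree" (10 rows: doi:10.1017/fms.2022.4, doi:10.1007/s00037-017-0162-2,
doi:10.1017/s0963548315000401 — approximation/zeros, not exact lattice evaluation), "universality of
intractability partition function Ising non-planar Istrail" (doi:10.1145/335305.335316), "Tutte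
polynomial complexity planar bipartite bounded degree Vertigan" (doi:10.1137/s0097539704446797,
doi:10.1017/s0963548300000195, doi:10.1201/9780429161612-9), "Cai Kowalczyk dichotomy k-regular real
edge functions" (doi:10.1007/978-3-642-13562-0_30, doi:10.1016/j.tcs.2012.01.021,
doi:10.1007/s00224-016-9671-7), "approximating the permanent of graphs with large factors"
(doi:10.1016/0304-3975(92)90234-7); `lit galaxy search "computational complexity Ising model
partition function three-dimensional lattice #P-complete non  [refs: 10.1017/fms.2022.4, 10.1007/s00037-017-0162-2, 10.1017/s0963548315000401, 10.1145/335305.335316, 10.1137/s0097539704446797, 10.1017/s0963548300000195, 10.1201/9780429161612-9, 10.1007/978-3-642-13562-0_30, 10.1016/j.tcs.2012.01.021, 10.1007/s00224-016-9671-7, 10.1016/0304-3975(92, 10.1016/j.aim.2010.06.021, 10.1017/s0305004100068936, doi:10.1017/fms.2022.4, doi:10.1007/s00037-017-0162-2, doi:10.10]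

Barriers (technique_class: complexity-barrier, discrete-holomorphicity-transplant): - technique_class: complexity-barrier, discrete-holomorphicity-transplant
- Literature.Barriers.CriticalPhenomena.LiouvilleRigidity: independent and complementary — Liouville
(in its narrowed form LiouvilleRigidityNarrow, same file family) blocks the conformal MAPS of the
planar route and explicitly NOT the discrete function theory, whose only recorded obstruction there
is LoeblMasbaum2011 Thm 4 (Pfaffian class), "so 'no discrete holomorphicity on ℤ³' stays a
heuristic"; this route supplies the lattice-side theorem for COMPLETE calculi and bites even on
Möbius-only (Clifford/monogenic) targets, as long as they are complete and domain-uniform.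
- Literature.Barriers.CriticalPhenomena.ScaleCovarianceNotMoebius: not engaged — no symmetry-upgrade
step; the route asserts nothing about clause (ii) of the conjunct.
- Literature.Barriers.CriticalPhenomena.BootstrapLatticeBlindness: not engaged; noted because its
`LatticeBlind` predicate is the pattern for stating a technique class as a Prop, as GridSAW's
`HasPolyTimeSAWCount` is for ours.
- Literature.Barriers.CriticalPhenomena.GridSAWCountingSharpPComplete: the sibling complexity
barrier (SAW conjunct): consistent, and reused as infrastructure (encodings, the `∀ f ∈ SharpP,
encodeNat ∘ f ∈ FP` collapse convention, the embedding-with-towers template); its scope caveat that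
solid domains are a refuge is inherited honestly — our hard Λ are thin (subdivided graphs are
width-1 tubes).
- Literature.Barriers.CriticalPhenomena.FKParafermioni

History (route lifecycle, newest last):
- 2026-08-15T13:47:56Z · CLOSED retired — not-a-thesis: assembly does not conclude the sub-problem Statement (operator:999:1257524)

sub-problem: Ising3DConformalLimit · status: closed(retired) · opened planner-plancard-CriticalPhenomena-Ising3DCon-cffcb640-0 2026-08-15T11:40:43Z · rev 0 · ledger route-CriticalPhenomena-HalfHolomorphic
GENERATED by the gate from the ledger (D-0016/17). Provers cite these decls: `theorem foo : Summit.CriticalPhenomena.Ising3DConformalLimit.Theses.HalfHolomorphic.<Decl> := …` in Summits/CriticalPhenomena/Ising3DConformalLimit/Theorems/<Name>.lean.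
-/

namespace Summit.CriticalPhenomena.Ising3DConformalLimit.Theses.HalfHolomorphic

open scoped BigOperators Topology Manifold Classical MeasureTheory ProbabilityTheory Matrix InnerProductSpace ComplexConjugate ContinuousMap
open Filter Set Function TopologicalSpace MeasureTheory

attribute [summit_statement] _root_.Ising3DConformalLimit

/-- item stmt-CriticalPhenomena-5307 · target · rank 0 · closed · moot by None · by planner
why it might fail: Only if #P ⊆ FP-type collapses are provable or via a modelling slip (encodings, Oracle.ofFun = binary answers, non-codes ↦ 0/[]); calculi defined only on thick domains or only at β_c are NOT covered — a relevance risk recorded under Kill criteria, not a truth risk.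
sources: JaegerVertiganWelsh1990, Valiant1979, Istrail2000, LiskiewiczOgiharaToda2003, doi:10.1007/978-3-642-13562-0_30, LoeblMasbaum2011
[target] X as in § Thesis: (i) PFUN ∈ FP ⇒ every #P function (as encodeNat ∘ f) is in FP; (ii) for
all naturals 0 < p < q, Oracle.ofFun (ZFUN p q) ∈ FP ⇒ the same collapse. PFUN = coefficient list
[e_0, …, e_B] of the even-subgraph polynomial of the nearest-neighbour graph on the decoded site
list Λ ⊂ ℤ × ℤ × ℤ (duplicates removed; non-codes ↦ []); ZFUN p q = Σ_(S ⊆ bonds(Λ), all Λ-degrees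
even) p^|S| q^(B−|S|) = q^B E_Λ(p/q) (non-codes ↦ 0). Sanity (planner's Test.lean, native_decide):
unit square ↦ q⁴ + p⁴ = 97 at (p,q) = (2,3), coefficient list [1,0,0,0,1]; three collinear sites ↦
q². -/
@[route_item "route-CriticalPhenomena-HalfHolomorphic"]
def Barrier : Prop :=
  ((fun w : List Bool => (((Literature.Computability.Complexity.encodingIntBool.pairBool (Literature.Computability.Complexity.encodingIntBool.pairBool Literature.Computability.Complexity.encodingIntBool)).listBool).decode w).elim ([] : List Bool) (fun Λ : List (ℤ × ℤ × ℤ) => (Literature.Computability.Complexity.encodingListNatBool).encode ((List.range (((((Λ).toFinset ×ˢ (Λ).toFinset).filter (fun xy : (ℤ × ℤ × ℤ) × (ℤ × ℤ × ℤ) => ((xy.1).1 - (xy.2).1).natAbs + ((xy.1).2.1 - (xy.2).2.1).natAbs + ((xy.1).2.2 - (xy.2).2.2).natAbs = 1)).image (fun xy => s(xy.1, xy.2))).card + 1)).map (fun j : ℕ => ((((((Λ).toFinset ×ˢ (Λ).toFinset).filter (fun xy : (ℤ × ℤ × ℤ) × (ℤ × ℤ × ℤ) => ((xy.1).1 - (xy.2).1).natAbs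 + ((xy.1).2.1 - (xy.2).2.1).natAbs + ((xy.1).2.2 - (xy.2).2.2).natAbs = 1)).image (fun xy => s(xy.1, xy.2))).powerset.filter (fun S => S.card = j ∧ (∀ v ∈ (Λ).toFinset, Even ((S.filter (fun e : Sym2 (ℤ × ℤ × ℤ) => v ∈ e)).card)))).card))))) ∈ Literature.Computability.Complexity.FP → ∀ f ∈ Literature.Computability.Complexity.SharpP, (Computability.encodeNat ∘ f) ∈ Literature.Computability.Complexity.FP) ∧ (∀ p q : ℕ, 0 < p → p < q → Literature.Computability.Complexity.Oracle.ofFun (fun w : List Bool => ((((Literature.Computability.Complexity.encodingIntBool.pairBool (Literature.Computability.Complexity.encodingIntBool.pairBool Literature.Computability.Complexity.encodingIntBool)).listBool).decode w).elim 0 (fun Λ : List (ℤ × ℤ × ℤ) => ∑ S ∈ ((((Λ).toFinset ×ˢ (Λ).toFinset).filter (fun xy : (ℤ × ℤ × ℤ) × (ℤ × ℤ × ℤ) => ((xy.1).1 - (xy.2).1).natAbs + ((xy.1).2.1 - (xy.2).2.1).natAbs + ((xy.1).2.2 - (xy.2).2.2).natAbs = 1)).image (fun xy => s(xy.1, xy.2))).powerset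 with (∀ v ∈ (Λ).toFinset, Even ((S.filter (fun e : Sym2 (ℤ × ℤ × ℤ) => v ∈ e)).card)), p ^ S.card * q ^ (((((Λ).toFinset ×ˢ (Λ).toFinset).filter (fun xy : (ℤ × ℤ × ℤ) × (ℤ × ℤ × ℤ) => ((xy.1).1 - (xy.2).1).natAbs + ((xy.1).2.1 - (xy.2).2.1).natAbs + ((xy.1).2.2 - (xy.2).2.2).natAbs = 1)).image (fun xy => s(xy.1, xy.2))).card - S.card)) : ℕ)) ∈ Literature.Computability.Complexity.FP → ∀ f ∈ Literature.Computability.Complexity.SharpP, (Computability.encodeNat ∘ f) ∈ Literature.Computability.Complexity.FP)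

/-- item stmt-CriticalPhenomena-5308 · crux · rank 2 · closed · moot by None · by planner
why it might fail: Not the combinatorics but its Lean size: a five-stage explicit string map with FP certificates (GridSAW's analogous Theorem 7 took ~30 files); a slip in conventions (per01Fn's matrix code, non-canonical input codes, exact list format of PFUN) breaks the identity as an equation on ALL strings.
sources: Valiant1979, JaegerVertiganWelsh1990, DagumLuby1992, LiskiewiczOgiharaToda2003
[crux] ONE-QUERY REDUCTION FROM VALIANT'S PERMANENT TO THE LATTICE POLYNOMIAL: there are pre, post ∈
FP with encodeNat (per01Fn w) = post (boolPair w (PFUN (pre w))) for every string w. Intended proof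
(elementary, sizes polynomial): decode w as a 0/1 matrix A (else the answer is 0 and post says so
after re-checking w); G(A) = bipartite graph of A, #PM(G(A)) = per A; replace each vertex of degree
d ≥ 2 by a path v¹u¹v²u²…u^(d−1)v^d with the i-th original edge moved to vⁱ (parsimonious for
perfect matchings; maximum degree 3) giving H with 2N vertices; pair the vertices of H arbitrarily
and join each pair by a NEW path of M = |E(H)| + 1 bonds (maximum degree 4): then e_(NM+N)(H⁺) =
#PM(H) exactly (an even subgraph contains each pendant path entirely or not at all; with all N
present, parity forces odd H-degrees and NM + N bonds force degree exactly 1; with fewer paths the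
size stays below NM) — checked by brute force in the planner's check.py on C₆ (2 = 2), K₃,₃ (6 = 6)
and random maximum-degree-3 graphs; embed the 2k-subdivision of H⁺ as an INDUCED subgraph Λ of ℤ³
(SubdivisionEmbedding made explicit and FP) so that e_(2kj)(Λ) = e_j(H⁺); post reads entry 2k(NM+N)
of the decoded list -/
@[route_item "route-CriticalPhenomena-HalfHolomorphic"]
def SymbolicHardness : Prop :=
  ∃ pre post : List Bool → List Bool, pre ∈ Literature.Computability.Complexity.FP ∧ post ∈ Literature.Computability.Complexity.FP ∧ ∀ w : List Bool, Computability.encodeNat (Literature.Computability.QuantumComplexity.per01Fn w) = post (Literature.Computability.Complexity.boolPair w ((fun w : List Bool => (((Literature.Computability.Complexity.encodingIntBool.pairBool (Literature.Computability.Complexity.encodingIntBool.pairBool Literature.Computability.Complexity.encodingIntBool)).listBool).decode w).elim ([] : List Bool) (fun Λ : List (ℤ × ℤ × ℤ) => (Literature.Computability.Complexity.encodingListNatBool).encode ((List.range (((((Λ).toFinset ×ˢ (Λ).toFinset).filter (fun xy : (ℤ × ℤ × ℤ) × (ℤ × ℤ × ℤ) => ((xy.1).1 - (xy.2).1).natAbs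 + ((xy.1).2.1 - (xy.2).2.1).natAbs + ((xy.1).2.2 - (xy.2).2.2).natAbs = 1)).image (fun xy => s(xy.1, xy.2))).card + 1)).map (fun j : ℕ => ((((((Λ).toFinset ×ˢ (Λ).toFinset).filter (fun xy : (ℤ × ℤ × ℤ) × (ℤ × ℤ × ℤ) => ((xy.1).1 - (xy.2).1).natAbs + ((xy.1).2.1 - (xy.2).2.1).natAbs + ((xy.1).2.2 - (xy.2).2.2).natAbs = 1)).image (fun xy => s(xy.1, xy.2))).powerset.filter (fun S => S.card = j ∧ (∀ v ∈ (Λ).toFinset, Even ((S.filter (fun e : Sym2 (ℤ × ℤ × ℤ) => v ∈ e)).card)))).card))))) (pre w)))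

/-- item stmt-CriticalPhenomena-5309 · crux · rank 3 · closed · moot by None · by planner
why it might fail: True by peeling (gcd(p^m, q^m) = 1, coefficients ≤ 2^B < modulus); the risk is Lean-size only — an FP certificate for a (B+1)-round big-integer loop and the exact canonical output format PFUN prescribes (length B+1, encodeNat entries).
sources: JaegerVertiganWelsh1990, Valiant1979, LiskiewiczOgiharaToda2003
[crux] ONE VALUE AT ONE RATIONAL COUPLING RETURNS THE WHOLE POLYNOMIAL, IN FP: for all naturals 0 <
p < q there are pre, post ∈ FP with PFUN w = post (boolPair w (encodeNat (ZFUN p q (pre w)))) for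
every string w. Intended proof: pre decodes w to Λ (if w is a non-code, post sees it on its first
component and answers []), computes B = |bonds(Λ)| and the m-DILATION Λ_m := mΛ ∪ {m x + j e_i : {x,
x+e_i} a bond of Λ, 0 ≤ j ≤ m} with m = B + 1, whose nearest-neighbour graph is exactly the
m-subdivision of that of Λ (for m ≥ 2 filled segments of distinct bonds stay at lattice distance ≥ 2
except at shared ends; sites of Λ at distance ≥ 2 stay non-adjacent) — so ZFUN p q (code Λ_m) = Σ_j
e_j(Λ) P^j Q^(B−j) with P = p^m, Q = q^m coprime (identity E_(Λ_m)(x) = E_Λ(x^m) checked by brute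
force in check.py on random site sets, m = 2, 3); since e_j ≤ 2^B < P when p ≥ 2, peel: e_0 ≡
W·Q^(−B) (mod P), subtract e_0 Q^B, divide by P, repeat B times; when p = 1 read the base-Q digits
instead (Q = q^m > 2^B); post re-encodes [e_0, …, e_B] with encodingListNatBool. Big-integer
arithmetic in FP with the tree's divFn/remFn/addFn and a polynomially bounded loop. [difficulty: L] -/
@[route_item "route-CriticalPhenomena-HalfHolomorphic"]
def ValuesDetermineCoefficients : Prop :=
  ∀ p q : ℕ, 0 < p → p < q → ∃ pre post : List Bool → List Bool, pre ∈ Literature.Computability.Complexity.FP ∧ post ∈ Literature.Computability.Complexity.FP ∧ ∀ w : List Bool, (fun w : List Bool => (((Literature.Computability.Complexity.encodingIntBool.pairBool (Literature.Computability.Complexity.encodingIntBool.pairBool Literature.Computability.Complexity.encodingIntBool)).listBool).decode w).elim ([] : List Bool) (fun Λ : List (ℤ × ℤ × ℤ) => (Literature.Computability.Complexity.encodingListNatBool).encode ((List.range (((((Λ).toFinset ×ˢ (Λ).toFinset).filter (fun xy : (ℤ × ℤ × ℤ) × (ℤ × ℤ × ℤ) => ((xy.1).1 - (xy.2).1).natAbs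 + ((xy.1).2.1 - (xy.2).2.1).natAbs + ((xy.1).2.2 - (xy.2).2.2).natAbs = 1)).image (fun xy => s(xy.1, xy.2))).card + 1)).map (fun j : ℕ => ((((((Λ).toFinset ×ˢ (Λ).toFinset).filter (fun xy : (ℤ × ℤ × ℤ) × (ℤ × ℤ × ℤ) => ((xy.1).1 - (xy.2).1).natAbs + ((xy.1).2.1 - (xy.2).2.1).natAbs + ((xy.1).2.2 - (xy.2).2.2).natAbs = 1)).image (fun xy => s(xy.1, xy.2))).powerset.filter (fun S => S.card = j ∧ (∀ v ∈ (Λ).toFinset, Even ((S.filter (fun e : Sym2 (ℤ × ℤ × ℤ) => v ∈ e)).card)))).card))))) w = post (Literature.Computability.Complexity.boolPair w (Computability.encodeNat ((fun w : List Bool => ((((Literature.Computability.Complexity.encodingIntBool.pairBool (Literature.Computability.Complexity.encodingIntBool.pairBool Literature.Computability.Complexity.encodingIntBool)).listBool).decode w).elim 0 (fun Λ : List (ℤ × ℤ × ℤ) => ∑ S ∈ ((((Λ).toFinset ×ˢ (Λ).toFinset).filter (fun xy : (ℤ × ℤ × ℤ) × (ℤ × ℤ × ℤ) => ((xy.1).1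 - (xy.2).1).natAbs + ((xy.1).2.1 - (xy.2).2.1).natAbs + ((xy.1).2.2 - (xy.2).2.2).natAbs = 1)).image (fun xy => s(xy.1, xy.2))).powerset with (∀ v ∈ (Λ).toFinset, Even ((S.filter (fun e : Sym2 (ℤ × ℤ × ℤ) => v ∈ e)).card)), p ^ S.card * q ^ (((((Λ).toFinset ×ˢ (Λ).toFinset).filter (fun xy : (ℤ × ℤ × ℤ) × (ℤ × ℤ × ℤ) => ((xy.1).1 - (xy.2).1).natAbs + ((xy.1).2.1 - (xy.2).2.1).natAbs + ((xy.1).2.2 - (xy.2).2.2).natAbs = 1)).image (fun xy => s(xy.1, xy.2))).card - S.card)) : ℕ)) (pre w))))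

/-- item stmt-CriticalPhenomena-5310 · crux · rank 4 · closed · moot by None · by planner
why it might fail: As typed: inducedness near a degree-6 image (all six ports busy) together with 'exactly 2k for ALL k ≥ k₀' needs detours that stay ≥ 2 away from every other path and port; a mis-set clause (not the folklore fact) is the risk — a refutation means RESTATE.
sources: LiskiewiczOgiharaToda2003, Istrail2000, Barahona1982
[crux] EVERY FINITE SIMPLE GRAPH OF MAXIMUM DEGREE ≤ 6 EMBEDS IN ℤ³ AS AN INDUCED, EQUAL-LENGTH,
EVEN SUBDIVISION: for a loopless edge list E on Fin n without repeated unordered edges and all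
degrees ≤ 6 there is k₀ such that for every k ≥ k₀ there are an injective placement φ : Fin n → ℤ³
and lattice paths π e (self-avoiding site lists, consecutive sites at ℓ¹-distance 1) of exactly 2k
bonds from φ e.1 to φ e.2 (e ∈ E), meeting vertex images only at their own two ends, pairwise
disjoint away from vertex images, and INDUCED: any two sites of Λ = φ(Fin n) ∪ ⋃ π e at ℓ¹-distance
1 are consecutive on some π e (hence the nearest-neighbour graph on Λ is the 2k-subdivision of (Fin
n, E), e_(2kj)(Λ) = e_j and all other coefficients vanish). Construction sketch: φ i = (8i, 0, 0)
(even sublattice ⇒ all path lengths even), the six lattice directions as ports, edge number m routed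
up to a private slab z ∈ [4m+6, 4m+9] and back (no crossings in 3D), lengths equalised to any 2k ≥
2k₀ ≍ n + |E| by U-detours of width 2 inside the slab (adds any even amount and keeps inducedness:
parallel runs at distance 2). [difficulty: M] -/
@[route_item "route-CriticalPhenomena-HalfHolomorphic"]
def SubdivisionEmbedding : Prop :=
  ∀ (n : ℕ) (E : List (Fin n × Fin n)), (∀ e ∈ E, e.1 ≠ e.2) → (E.map (fun e => s(e.1, e.2))).Nodup → (∀ v : Fin n, (E.filter (fun e => v ∈ s(e.1, e.2))).length ≤ 6) → ∃ k₀ : ℕ, ∀ k : ℕ, k₀ ≤ k → ∃ (φ : Fin n → ℤ × ℤ × ℤ) (π : Fin n × Fin n → List (ℤ × ℤ × ℤ)), Function.Injective φ ∧ (∀ e ∈ E, (π e).head? = some (φ e.1) ∧ (π e).getLast? = some (φ e.2) ∧ (π e).length = 2 * k + 1 ∧ (π e).Nodup ∧ List.IsChain (fun x y : ℤ × ℤ × ℤ => ((x).1 - (y).1).natAbs + ((x).2.1 - (y).2.1).natAbs + ((x).2.2 - (y).2.2).natAbs = 1) (π e)) ∧ (∀ e ∈ E, ∀ x ∈ π e,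 ∀ v : Fin n, x = φ v → (v = e.1 ∨ v = e.2)) ∧ (∀ e ∈ E, ∀ e' ∈ E, e ≠ e' → ∀ x : ℤ × ℤ × ℤ, x ∈ π e → x ∈ π e' → ∃ v : Fin n, x = φ v) ∧ (∀ x y : ℤ × ℤ × ℤ, (x ∈ Set.range φ ∨ ∃ e ∈ E, x ∈ π e) → (y ∈ Set.range φ ∨ ∃ e ∈ E, y ∈ π e) → ((x).1 - (y).1).natAbs + ((x).2.1 - (y).2.1).natAbs + ((x).2.2 - (y).2.2).natAbs = 1 → ∃ e ∈ E, [x, y] <:+: π e ∨ [y, x] <:+: π e)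

/-- item stmt-CriticalPhenomena-5311 · support · rank 9 · closed · moot by None · by planner
sources: Valiant1979, AroraBarak2009
[support] HARDNESS TRANSFER (provable now; 8-line script rc 0 in the planner's ProofTest.lean): if
pre, post ∈ FP and encodeNat (per01Fn w) = post (boolPair w (encodeNat (Z (pre w)))) for all w, then
IsSharpPHardFun Z — Valiant (permanent01_isSharpPHardFun_holds) puts encodeNat ∘ g in FPRel
(Oracle.ofFun per01Fn) for every g ∈ #P, the identity puts Oracle.ofFun per01Fn in FPRel
(Oracle.ofFun Z) (postPre_mem_FPRel (self_mem_FPRel _) hpre hpost, funext + Oracle.ofFun_apply), and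
OracleAlg.FPRel_subset_FPRel_of_mem_FPRel composes. Imports:
QuantumComplexity.PermanentHardnessProofs, Complexity.OracleClosure, Complexity.CountingProofs.
[difficulty: provable-now] -/
@[route_item "route-CriticalPhenomena-HalfHolomorphic"]
def HardnessOfReduction : Prop :=
  ∀ Z : List Bool → ℕ, (∃ pre post : List Bool → List Bool, pre ∈ Literature.Computability.Complexity.FP ∧ post ∈ Literature.Computability.Complexity.FP ∧ ∀ w : List Bool, Computability.encodeNat (Literature.Computability.QuantumComplexity.per01Fn w) = post (Literature.Computability.Complexity.boolPair w (Computability.encodeNat (Z (pre w))))) → Literature.Computability.Complexity.IsSharpPHardFun Z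

/-- item stmt-CriticalPhenomena-5312 · support · rank 9 · closed · moot by None · by planner
sources: AroraBarak2009, Valiant1979
[support] COLLAPSE (provable now; 2-line script rc 0 in ProofTest.lean): a #P-hard Z whose
binary-answer oracle Oracle.ofFun Z lies in FP puts every #P function (as encodeNat ∘ f) in FP —
`FPRel_subset_FP_of_mem_FP hFP (hZ f hf)` (OracleEmptyFP.lean). [difficulty: provable-now] -/
@[route_item "route-CriticalPhenomena-HalfHolomorphic"]
def CollapseOfPolyTime : Prop :=
  ∀ Z : List Bool → ℕ, Literature.Computability.Complexity.IsSharpPHardFun Z → Literature.Computability.Complexity.Oracle.ofFun Z ∈ Literature.Computability.Complexity.FP → ∀ f ∈ Literature.Computability.Complexity.SharpP, (Computability.encodeNat ∘ f) ∈ Literature.Computability.Complexity.FP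

/-- item stmt-CriticalPhenomena-5313 · assembly · rank 1 · closed · moot by None · by planner
sources: Valiant1979, AroraBarak2009
[assembly] SymbolicHardness → ValuesDetermineCoefficients → Barrier. -/
@[route_item "route-CriticalPhenomena-HalfHolomorphic"]
def Assembly : Prop :=
  SymbolicHardness → ValuesDetermineCoefficients → Barrier

end Summit.CriticalPhenomena.Ising3DConformalLimit.Theses.HalfHolomorphic
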